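import Literature.NumberTheory.Sieve.BourgainSarnakZieglerCriterion
import Literature.NumberTheory.LFunctions.MertensTail
import Mathlib.Data.Nat.Totient
import Mathlib.Algebra.Order.Chebyshev
import Mathlib.Analysis.SpecialFunctions.Pow.Real
import Mathlib.Analysis.SpecialFunctions.Sqrt
import HarnessLib

/-!
# Proof of the Bourgain–Sarnak–Ziegler criterion (BSZ 2013, Theorem 2)

This file discharges the named fact
`Literature.NumberTheory.Sieve.bourgainSarnakZiegler_criterion`
(`BourgainSarnakZieglerCriterion.lean`): J. Bourgain, P. Sarnak, T. Ziegler, *Disjointness of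
Moebius from horocycle flows*, Dev. Math. 28 (2013), 67–83, **Theorem 2** (arXiv:1110.0992, §2),
with `τ₀ = e^{-64}`:

* `bourgainSarnakZiegler_criterion_holds : bourgainSarnakZiegler_criterion`.

## The argument (BSZ §2) and how it is formalised

Everything is in the sub-namespace `BourgainSarnakZiegler`.  As in the paper, `[1, N]` is
decomposed, up to a small exceptional set, into disjoint "well-factored" sets
`G_j = {x·y : x ∈ P_j, y ∈ Y_j, xy ≤ N}` where `P_j` is a block of primes and `Y_j` the integers
free of the primes of the blocks `≤ j` (BSZ (2.6), (2.10''), (2.11)); on `G_j` one has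
`ν(xy) = ν(x)ν(y)` (BSZ (2.15)–(2.16)), and Cauchy–Schwarz in `y` (BSZ (2.17)) produces the
diagonal terms (BSZ (2.19)–(2.20)) and the off-diagonal correlation sums, which are the hypothesis
(1.3) (BSZ (2.21)).  The abstract form of this is `eventually_norm_sum_le`: for a strictly
increasing enumeration `q` of primes `> D`, cut into `J` blocks of `H` consecutive indices, with
`L = ∑_{i < JH} 1/qᵢ`, for every `δ > 0` and all large `N`,

  `‖∑_{n ≤ N} ν(n) F(n)‖ ≤ (√((1 + H/D) · L · (1/H + τ)) + e^{-L} + (H/D) L + δ) · N`.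

Ingredients: the decomposition `Ioc_subset_union` ((0, N] ⊆ ⋃ G_j ∪ sifted ∪ bad) with
`mul_injOn_tSet`, `gSet_disjoint`; the sifted integers (no factor `qᵢ`) number
`≤ (N + ∏ qᵢ) e^{-L}` (`card_sifted_le`, periodicity of coprimality and `1 - 1/p ≤ e^{-1/p}`);
the bad integers (two factors, or a square, from one block) number `≤ N ∑_j L_j² ≤ N (H/D) L`
(`card_bad_le`, `sum_sq_le`); the block estimate `norm_sum_gSet_le`
(`‖∑_{G_j} ν F‖ ≤ √#Y_j · √(N L_j (1 + τH))`); and the count `∑_j H #Y_j ≤ N + HN/D + HJ`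
(`sum_card_ySet_le`, telescoping over the blocks).

Two deliberate deviations from the printed bookkeeping (the statement proved is exactly the
printed Theorem 2):

* BSZ use the `(1+α)`-adic blocks `P_j = primes ∩ [(1+α)^j, (1+α)^{j+1}]`, `j₀ ≤ j ≤ j₁ = j₀²`,
  and truncate `y < N/(1+α)^{j+1}` uniformly in `x ∈ P_j`; this costs the estimate (2.13), whose
  displayed right-hand side `N{α log(j₁/j₀) + …}` has `log(j₁/j₀) = log j₀ → ∞`, and needs the
  prime number theorem in the short ranges `[(1+α)^j, (1+α)^{j+1}]` ((2.7)–(2.8)).  We instead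
  keep the exact range `xy ≤ N` (hypothesis (1.3) is available at every `M = ⌊N / max(x₁, x₂)⌋`)
  and use blocks of `H` *consecutive* primes: then only the two-sided Mertens estimate
  `∑_{D₀ < p ≤ e^{1/τ}} 1/p = log(1/τ) - log log D₀ + O(1)` is needed, which the tree proves
  (`Literature.NumberTheory.LFunctions.MertensBound.loglog_sub_loglog_le_sum_inv_prime`,
  `….MertensBound.sum_inv_prime_le`, from Chebyshev's bounds in Mathlib).
* Parameters (`criterion_of_le`): `u = 1/τ ≥ e^{64}`, `k = ⌈u⌉`, `H = k²`, `D₀ = k^{10}`, the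
  primes of `(D₀, ⌊e^u⌋]` in blocks of `H` (the `< H` largest ones dropped), so that
  `log u - log(10 log k) - 0.6/log k - k⁻⁸ ≤ L ≤ log u + 4`; the resulting constant is
  `≤ 1.7 √(τ log(1/τ)) < 2 √(τ log(1/τ))` (`endgame`; the paper takes `α = √τ`).

## References

* J. Bourgain, P. Sarnak, T. Ziegler, *Disjointness of Moebius from horocycle flows*, in: From
  Fourier Analysis and Number Theory to Radon Transforms and Geometry, Dev. Math. 28, Springer
  (2013), 67–83; arXiv:1110.0992, §2. [BourgainSarnakZiegler2013]
* G. H. Hardy, E. M. Wright, *An Introduction to the Theory of Numbers*, Thm 427 (Mertens), as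
  proved in `Literature/NumberTheory/LFunctions/MertensTail.lean`. [HardyWright2008]
-/

open Filter Finset
open scoped ComplexConjugate

namespace Literature.NumberTheory.Sieve

namespace BourgainSarnakZiegler

variable {q : ℕ → ℕ} {H : ℕ}

/-! ### Notation (local to this file; these are abbreviations, not definitions)

* `block H j` — the `j`-th index block `[jH, jH + H)`;
* `ySet q H N j` — the admissible cofactors `1 ≤ y ≤ N / q(jH)` free of the primes `q i`,
  `i < jH + H` (the blocks `≤ j`);
* `tSet q H N j` — the pairs `(i, y)`, `i ∈ block H j`, `y ∈ ySet q H N j`, `q i * y ≤ N`;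
* `gSet q H N j` — the well-factored integers of type `j`, `{q i * y : (i, y) ∈ tSet q H N j}`;
* `sifted q n N` — the `m ∈ (0, N]` with no factor `q i`, `i < n`;
* `bad q H J N` — the `m ∈ (0, N]` divisible by `q i * q i'` for some `i, i'` in one block `j < J`.
-/

/-- The `j`-th index block `[jH, jH + H)`. -/
local notation3 (prettyPrint := false) "block" H:max j:max => Finset.Ico (j * H) (j * H + H)

/-- The admissible cofactors of type `j`. -/
local notation3 (prettyPrint := false) "ySet" q:max H:max N:max j:max =>
  Finset.filter (fun y => ∀ i < j * H + H, ¬ q i ∣ y) (Finset.Icc 1 (N / q (j * H)))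

/-- The pairs `(i, y)` of type `j` with `q i * y ≤ N`. -/
local notation3 (prettyPrint := false) "tSet" q:max H:max N:max j:max =>
  Finset.filter (fun p : ℕ × ℕ => q p.1 * p.2 ≤ N) ((block H j) ×ˢ (ySet q H N j))

/-- The well-factored integers of type `j`. -/
local notation3 (prettyPrint := false) "gSet" q:max H:max N:max j:max =>
  Finset.image (fun p : ℕ × ℕ => q p.1 * p.2) (tSet q H N j)

/-- The sifted integers. -/
local notation3 (prettyPrint := false) "sifted" q:max n:max N:max =>
  Finset.filter (fun m => ∀ i < n, ¬ q i ∣ m) (Finset.Ioc 0 N)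

/-- The bad integers. -/
local notation3 (prettyPrint := false) "bad" q:max H:max J:max N:max =>
  Finset.biUnion (Finset.range J) (fun j => Finset.biUnion ((block H j) ×ˢ (block H j))
    (fun p : ℕ × ℕ => Finset.filter (fun m => q p.1 * q p.2 ∣ m) (Finset.Ioc 0 N)))

/-! More local notation: `cFun q F ν N i y = [qᵢ y ≤ N] ν(qᵢ) F(qᵢ y)`,
`aFun q H F ν N j y = ∑_{i ∈ block j} cFun q F ν N i y`, and the correlation sum
`corr q F N i i' = ∑_{1 ≤ y ≤ N / max(qᵢ, qᵢ')} F(qᵢ y) conj F(qᵢ' y)`. -/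

/-- `[qᵢ y ≤ N] ν(qᵢ) F(qᵢ y)`. -/
local notation3 (prettyPrint := false) "cFun" q:max F:max ν:max N:max i:max y:max =>
  (if q i * y ≤ N then (ν : ArithmeticFunction ℂ) (q i) * F (q i * y) else (0 : ℂ))

/-- `∑_{i ∈ block j} cFun q F ν N i y`. -/
local notation3 (prettyPrint := false) "aFun" q:max H:max F:max ν:max N:max j:max y:max =>
  ∑ i ∈ block H j, cFun q F ν N i y

/-- The correlation sum `∑_{y ≤ N / max(qᵢ, qᵢ')} F(qᵢ y) conj F(qᵢ' y)`. -/
local notation3 (prettyPrint := false) "corr" q:max F:max N:max i:max i':max =>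
  ∑ y ∈ Finset.Icc 1 (N / max (q i) (q i')), F (q i * y) * (starRingEnd ℂ) (F (q i' * y))

/-- Membership in the `j`-th index block. [folklore] -/
theorem mem_block {j i : ℕ} : i ∈ block H j ↔ j * H ≤ i ∧ i < j * H + H := Finset.mem_Ico

/-- Each index block has `H` elements. [folklore] -/
theorem card_block (j : ℕ) : (block H j).card = H := by
  rw [Nat.card_Ico]; omega

/-- `jH + H ≤ JH` for `j < J`. [folklore] -/
theorem succ_mul_le {j J : ℕ} (hj : j < J) : j * H + H ≤ J * H := by
  have : (j + 1) * H ≤ J * H := Nat.mul_le_mul_right H hj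
  linarith [add_mul j 1 H, one_mul H]

/-- Indices of the blocks `j < J` are `< JH`. [folklore] -/
theorem lt_of_mem_block {j J i : ℕ} (hj : j < J) (hi : i ∈ block H j) : i < J * H :=
  lt_of_lt_of_le (mem_block.1 hi).2 (succ_mul_le hj)

/-- `(i, y) ↦ q i * y` is injective on `tSet`. [folklore] -/
theorem mul_injOn_tSet (hq : StrictMono q) {J N j : ℕ} (hj : j < J)
    (hp : ∀ i < J * H, (q i).Prime) :
    Set.InjOn (fun p : ℕ × ℕ => q p.1 * p.2) (tSet q H N j : Set (ℕ × ℕ)) := by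
  rintro ⟨i, y⟩ hiy ⟨i', y'⟩ hiy' h
  simp only [Finset.mem_coe, Finset.mem_filter, Finset.mem_product,
    Finset.mem_Icc] at hiy hiy' h
  have hib := mem_block.1 hiy.1.1
  have hpi : (q i).Prime := hp i (lt_of_mem_block hj hiy.1.1)
  have hpi' : (q i').Prime := hp i' (lt_of_mem_block hj hiy'.1.1)
  have hndvd : ¬ q i ∣ y' := hiy'.1.2.2 i hib.2
  have hdvd : q i ∣ q i' * y' := ⟨y, h.symm⟩
  have h1 : q i ∣ q i' := (hpi.dvd_mul.mp hdvd).resolve_right hndvd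
  have hii' : i = i' := hq.injective ((Nat.prime_dvd_prime_iff_eq hpi hpi').mp h1)
  subst hii'
  have hy : y = y' := Nat.eq_of_mul_eq_mul_left hpi.pos h
  rw [hy]

/-- `#G_j = #T_j` (unique factorisation of the well-factored integers of type `j`). [folklore] -/
theorem card_gSet (hq : StrictMono q) {J N j : ℕ} (hj : j < J) (hp : ∀ i < J * H, (q i).Prime) :
    (gSet q H N j).card = (tSet q H N j).card :=
  Finset.card_image_of_injOn (mul_injOn_tSet hq hj hp)

/-- `G_j ⊆ [1, N]`. [folklore] -/
theorem gSet_subset_Ioc {J N j : ℕ} (hj : j < J) (hp : ∀ i < J * H, (q i).Prime) :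
    gSet q H N j ⊆ Finset.Ioc 0 N := by
  intro m hm
  simp only [Finset.mem_image, Finset.mem_filter, Finset.mem_product,
    Finset.mem_Icc, Prod.exists] at hm
  obtain ⟨i, y, ⟨⟨hi, ⟨hy1, _⟩, _⟩, hle⟩, rfl⟩ := hm
  have hpi : (q i).Prime := hp i (lt_of_mem_block hj hi)
  rw [Finset.mem_Ioc]
  exact ⟨Nat.mul_pos hpi.pos (by omega), hle⟩

/-- The sets `G_j`, `j < J`, are pairwise disjoint (the type of `n` is the block of its least
prime factor among the `qᵢ`). [folklore] -/
theorem gSet_disjoint (hq : StrictMono q) {J N j j' : ℕ} (hj : j < J) (hj' : j' < J) (hne : j ≠ j')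
    (hp : ∀ i < J * H, (q i).Prime) : Disjoint (gSet q H N j) (gSet q H N j') := by
  wlog hlt : j < j' generalizing j j'
  · exact (this hj' hj hne.symm (lt_of_le_of_ne (not_lt.mp hlt) hne.symm)).symm
  rw [Finset.disjoint_left]
  intro m hm hm'
  simp only [Finset.mem_image, Finset.mem_filter, Finset.mem_product,
    Finset.mem_Icc, Prod.exists] at hm hm'
  obtain ⟨i, y, ⟨⟨hi, _, _⟩, _⟩, rfl⟩ := hm
  obtain ⟨i', y', ⟨⟨hi', _, hfree'⟩, _⟩, heq⟩ := hm'
  have hib := mem_block.1 hi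
  have hib' := mem_block.1 hi'
  have hpi : (q i).Prime := hp i (lt_of_mem_block hj hi)
  have hpi' : (q i').Prime := hp i' (lt_of_mem_block hj' hi')
  have hlt' : i < j' * H + H := by
    have := succ_mul_le (H := H) hlt
    omega
  have hndvd : ¬ q i ∣ y' := hfree' i hlt'
  have hdvd : q i ∣ q i' * y' := ⟨y, heq⟩
  have h1 : q i ∣ q i' := (hpi.dvd_mul.mp hdvd).resolve_right hndvd
  have hii' : i = i' := hq.injective ((Nat.prime_dvd_prime_iff_eq hpi hpi').mp h1)
  subst hii'
  have := succ_mul_le (H := H) hlt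
  omega

/-- The decomposition: every `1 ≤ m ≤ N` is well-factored of some type `j < J`, or sifted, or bad.
[folklore] -/
theorem Ioc_subset_union (hq : StrictMono q) (hH : 0 < H) {J N : ℕ}
    (hp : ∀ i < J * H, (q i).Prime) :
    Finset.Ioc 0 N ⊆
      (Finset.range J).biUnion (fun j => gSet q H N j) ∪ sifted q (J * H) N ∪ bad q H J N := by
  intro m hm
  have hm' := Finset.mem_Ioc.1 hm
  by_cases hex : ∃ i, i < J * H ∧ q i ∣ m
  swap
  · push Not at hex
    refine Finset.mem_union_left _ (Finset.mem_union_right _ ?_)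
    simp only [Finset.mem_filter]
    exact ⟨hm, hex⟩
  set i₀ := Nat.find hex with hi₀def
  have hi₀ : i₀ < J * H ∧ q i₀ ∣ m := Nat.find_spec hex
  have hmin : ∀ i < i₀, ¬ (i < J * H ∧ q i ∣ m) := fun i hi => Nat.find_min hex hi
  set j := i₀ / H with hjdef
  have hj : j < J := (Nat.div_lt_iff_lt_mul hH).mpr hi₀.1
  have hjle : j * H ≤ i₀ := Nat.div_mul_le_self i₀ H
  have hilt : i₀ < j * H + H := Nat.lt_div_mul_add hH
  have hp₀ : (q i₀).Prime := hp i₀ hi₀.1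
  by_cases hb : m ∈ bad q H J N
  · exact Finset.mem_union_right _ hb
  refine Finset.mem_union_left _ (Finset.mem_union_left _ ?_)
  rw [Finset.mem_biUnion]
  refine ⟨j, Finset.mem_range.mpr hj, ?_⟩
  obtain ⟨y, hy⟩ := hi₀.2
  rw [Finset.mem_image]
  refine ⟨(i₀, y), ?_, hy.symm⟩
  have hfree : ∀ i' < j * H + H, ¬ q i' ∣ y := by
    intro i' hi' hdvd
    apply hb
    have hi'm : q i' ∣ m := hy ▸ Dvd.dvd.mul_left hdvd _
    have hi'lt : i' < J * H := lt_of_lt_of_le hi' (succ_mul_le hj)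
    have hi₀i' : i₀ ≤ i' := by
      by_contra hcon
      exact hmin i' (not_le.mp hcon) ⟨hi'lt, hi'm⟩
    simp only [Finset.mem_biUnion, Finset.mem_range, Finset.mem_product, Finset.mem_filter,
      Prod.exists]
    refine ⟨j, hj, i₀, i', ⟨mem_block.2 ⟨hjle, hilt⟩, mem_block.2 ⟨hjle.trans hi₀i', hi'⟩⟩, hm, ?_⟩
    by_cases hii : i₀ = i'
    · subst hii
      rw [hy]
      exact mul_dvd_mul_left _ hdvd
    · have hcop : Nat.Coprime (q i₀) (q i') :=
        (Nat.coprime_primes hp₀ (hp i' hi'lt)).mpr (fun h => hii (hq.injective h))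
      exact hcop.mul_dvd_of_dvd_of_dvd hi₀.2 hi'm
  have hy0 : 0 < y := by
    rcases Nat.eq_zero_or_pos y with h | h
    · rw [h, mul_zero] at hy; omega
    · exact h
  simp only [Finset.mem_filter, Finset.mem_product, Finset.mem_Icc]
  refine ⟨⟨mem_block.2 ⟨hjle, hilt⟩, ⟨hy0, ?_⟩, hfree⟩, hy ▸ hm'.2⟩
  have hqpos : 0 < q (j * H) := (hp (j * H) (lt_of_le_of_lt hjle hi₀.1)).pos
  rw [Nat.le_div_iff_mul_le hqpos]
  calc y * q (j * H) ≤ y * q i₀ := Nat.mul_le_mul_left y (hq.monotone hjle)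
    _ = m := by rw [hy, mul_comm]
    _ ≤ N := hm'.2


/-! ### Counting the sifted and the bad integers -/

/-- `#{m ≤ N : (Q, m) = 1} ≤ (⌊N/Q⌋ + 1) φ(Q)` (coprimality is `Q`-periodic). [folklore] -/
theorem card_filter_coprime_le {Q : ℕ} (hQ : 0 < Q) (N : ℕ) :
    ((Finset.Ioc 0 N).filter (fun m => Nat.Coprime Q m)).card ≤ (N / Q + 1) * Nat.totient Q := by
  calc ((Finset.Ioc 0 N).filter (fun m => Nat.Coprime Q m)).card
      ≤ ((Finset.range (N / Q + 1)).biUnion fun k =>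
          (Finset.Ico (k * Q) (k * Q + Q)).filter (fun m => Nat.Coprime Q m)).card := by
        apply Finset.card_le_card
        intro m hm
        simp only [Finset.mem_filter, Finset.mem_Ioc] at hm
        simp only [Finset.mem_biUnion, Finset.mem_range, Finset.mem_filter, Finset.mem_Ico]
        refine ⟨m / Q, ?_, ⟨Nat.div_mul_le_self m Q, Nat.lt_div_mul_add hQ⟩, hm.2⟩
        exact Nat.lt_succ_of_le (Nat.div_le_div_right hm.1.2)
    _ ≤ ∑ k ∈ Finset.range (N / Q + 1),
          ((Finset.Ico (k * Q) (k * Q + Q)).filter (fun m => Nat.Coprime Q m)).card :=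
        Finset.card_biUnion_le
    _ = (N / Q + 1) * Nat.totient Q := by
        simp only [Nat.filter_coprime_Ico_eq_totient, Finset.sum_const, Finset.card_range,
          smul_eq_mul]

/-- `φ(∏ qᵢ) = ∏ (qᵢ - 1)` for distinct primes. [folklore] -/
theorem totient_prod_eq (hq : StrictMono q) {n : ℕ} (hp : ∀ i < n, (q i).Prime) :
    Nat.totient (∏ i ∈ Finset.range n, q i) = ∏ i ∈ Finset.range n, (q i - 1) := by
  induction n with
  | zero => simp
  | succ n ih =>
    have hp' : ∀ i < n, (q i).Prime := fun i hi => hp i (Nat.lt_succ_of_lt hi)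
    have hpn : (q n).Prime := hp n n.lt_succ_self
    have hcop : Nat.Coprime (∏ i ∈ Finset.range n, q i) (q n) := by
      apply Nat.Coprime.prod_left
      intro i hi
      rw [Finset.mem_range] at hi
      exact (Nat.coprime_primes (hp' i hi) hpn).mpr (fun h => (ne_of_lt hi) (hq.injective h))
    rw [Finset.prod_range_succ, Finset.prod_range_succ, Nat.totient_mul hcop, ih hp',
      Nat.totient_prime hpn]

/-- The sifted set is small: `#sifted ≤ (N + Q) e^{-L}`, `Q = ∏ qᵢ`, `L = ∑ 1/qᵢ`. [folklore] -/
theorem card_sifted_le (hq : StrictMono q) {n N : ℕ} (hp : ∀ i < n, (q i).Prime) :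
    ((sifted q n N).card : ℝ) ≤
      (N + ∏ i ∈ Finset.range n, (q i : ℝ)) *
        Real.exp (-∑ i ∈ Finset.range n, (1 : ℝ) / q i) := by
  set Q := ∏ i ∈ Finset.range n, q i with hQdef
  have hQpos : 0 < Q := Finset.prod_pos fun i hi => (hp i (Finset.mem_range.1 hi)).pos
  have hQreal : (Q : ℝ) = ∏ i ∈ Finset.range n, (q i : ℝ) := by
    rw [hQdef]; push_cast; rfl
  have hsub : sifted q n N ⊆ (Finset.Ioc 0 N).filter (fun m => Nat.Coprime Q m) := by
    intro m hm
    simp only [Finset.mem_filter] at hm ⊢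
    refine ⟨hm.1, ?_⟩
    apply Nat.Coprime.prod_left
    intro i hi
    exact (Nat.Prime.coprime_iff_not_dvd (hp i (Finset.mem_range.1 hi))).mpr
      (hm.2 i (Finset.mem_range.1 hi))
  have h1 : (sifted q n N).card ≤ (N / Q + 1) * ∏ i ∈ Finset.range n, (q i - 1) := by
    rw [← totient_prod_eq hq hp]
    exact (Finset.card_le_card hsub).trans (card_filter_coprime_le hQpos N)
  have h2 : ((sifted q n N).card : ℝ) ≤
      ((N : ℝ) / Q + 1) * ∏ i ∈ Finset.range n, ((q i : ℝ) - 1) := by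
    have h1' : ((sifted q n N).card : ℝ) ≤
        ((N / Q : ℕ) + 1 : ℝ) * ∏ i ∈ Finset.range n, ((q i - 1 : ℕ) : ℝ) := by
      exact_mod_cast h1
    refine h1'.trans ?_
    have hprod : ∏ i ∈ Finset.range n, ((q i - 1 : ℕ) : ℝ) =
        ∏ i ∈ Finset.range n, ((q i : ℝ) - 1) := by
      apply Finset.prod_congr rfl
      intro i hi
      rw [Nat.cast_sub (hp i (Finset.mem_range.1 hi)).one_le, Nat.cast_one]
    rw [hprod]
    have hdiv : ((N / Q : ℕ) : ℝ) ≤ (N : ℝ) / Q := Nat.cast_div_le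
    apply mul_le_mul_of_nonneg_right (by linarith)
    · exact Finset.prod_nonneg fun i hi => by
        have : (1 : ℝ) ≤ q i := by exact_mod_cast (hp i (Finset.mem_range.1 hi)).one_le
        linarith
  have h3 : ∏ i ∈ Finset.range n, ((q i : ℝ) - 1) =
      (Q : ℝ) * ∏ i ∈ Finset.range n, (1 - 1 / (q i : ℝ)) := by
    rw [hQreal, ← Finset.prod_mul_distrib]
    apply Finset.prod_congr rfl
    intro i hi
    have : (q i : ℝ) ≠ 0 := by exact_mod_cast (hp i (Finset.mem_range.1 hi)).ne_zero
    field_simp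
  have h4 : ∏ i ∈ Finset.range n, (1 - 1 / (q i : ℝ)) ≤
      Real.exp (-∑ i ∈ Finset.range n, (1 : ℝ) / q i) := by
    rw [← Finset.sum_neg_distrib, Real.exp_sum]
    apply Finset.prod_le_prod
    · intro i hi
      have : (1 : ℝ) ≤ q i := by exact_mod_cast (hp i (Finset.mem_range.1 hi)).one_le
      have : 1 / (q i : ℝ) ≤ 1 := by
        rw [div_le_one (by linarith)]; exact this
      linarith
    · intro i hi
      have := Real.add_one_le_exp (-(1 / (q i : ℝ)))
      linarith
  have hQr : (0 : ℝ) < Q := by exact_mod_cast hQpos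
  calc ((sifted q n N).card : ℝ)
      ≤ ((N : ℝ) / Q + 1) * ∏ i ∈ Finset.range n, ((q i : ℝ) - 1) := h2
    _ = ((N : ℝ) + Q) * ∏ i ∈ Finset.range n, (1 - 1 / (q i : ℝ)) := by
        rw [h3]; field_simp
    _ ≤ ((N : ℝ) + Q) * Real.exp (-∑ i ∈ Finset.range n, (1 : ℝ) / q i) := by
        apply mul_le_mul_of_nonneg_left h4; positivity
    _ = _ := by rw [hQreal]

/-- The bad set is small: `#bad ≤ N ∑_j L_j²`, `L_j = ∑_{i ∈ block j} 1/qᵢ`. [folklore] -/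
theorem card_bad_le (J N : ℕ) :
    ((bad q H J N).card : ℝ) ≤
      N * ∑ j ∈ Finset.range J, (∑ i ∈ block H j, (1 : ℝ) / q i) ^ 2 := by
  calc ((bad q H J N).card : ℝ)
      ≤ ∑ j ∈ Finset.range J, (((block H j ×ˢ block H j).biUnion fun p =>
          (Finset.Ioc 0 N).filter (fun m => q p.1 * q p.2 ∣ m)).card : ℝ) := by
        exact_mod_cast Finset.card_biUnion_le
    _ ≤ ∑ j ∈ Finset.range J, ∑ p ∈ block H j ×ˢ block H j,
          (((Finset.Ioc 0 N).filter (fun m => q p.1 * q p.2 ∣ m)).card : ℝ) := by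
        apply Finset.sum_le_sum
        intro j _
        exact_mod_cast Finset.card_biUnion_le
    _ = ∑ j ∈ Finset.range J, ∑ p ∈ block H j ×ˢ block H j, ((N / (q p.1 * q p.2) : ℕ) : ℝ) := by
        simp only [Nat.Ioc_filter_dvd_card_eq_div]
    _ ≤ ∑ j ∈ Finset.range J, ∑ p ∈ block H j ×ˢ block H j, (N : ℝ) / (q p.1 * q p.2 : ℕ) := by
        apply Finset.sum_le_sum; intro j _
        apply Finset.sum_le_sum; intro p _
        exact Nat.cast_div_le
    _ = N * ∑ j ∈ Finset.range J, (∑ i ∈ block H j, (1 : ℝ) / q i) ^ 2 := by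
        rw [Finset.mul_sum]
        apply Finset.sum_congr rfl
        intro j _
        rw [sq, Finset.sum_mul_sum, Finset.sum_product, Finset.mul_sum]
        apply Finset.sum_congr rfl
        intro i _
        rw [Finset.mul_sum]
        apply Finset.sum_congr rfl
        intro i' _
        push_cast
        ring

/-- Summing over the blocks `j < J` is summing over the indices `i < J H`. [folklore] -/
theorem sum_blocks_eq {M : Type*} [AddCommMonoid M] (f : ℕ → M) (J : ℕ) :
    ∑ j ∈ Finset.range J, ∑ i ∈ block H j, f i = ∑ i ∈ Finset.range (J * H), f i := by
  induction J with
  | zero => simp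
  | succ J ih =>
    rw [Finset.sum_range_succ, ih, add_one_mul, Finset.range_eq_Ico, Finset.range_eq_Ico,
      Finset.sum_Ico_consecutive _ (Nat.zero_le _) (Nat.le_add_right _ _)]

/-- `∑_j L_j² ≤ (H/D) L` when every `qᵢ ≥ D`. [folklore] -/
theorem sum_sq_le (hq : StrictMono q) {D : ℝ} (hD : 0 < D) (hD0 : D ≤ q 0) (J : ℕ) :
    ∑ j ∈ Finset.range J, (∑ i ∈ block H j, (1 : ℝ) / q i) ^ 2 ≤
      H / D * ∑ i ∈ Finset.range (J * H), (1 : ℝ) / q i := by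
  rw [← sum_blocks_eq (H := H) (fun i => (1 : ℝ) / q i), Finset.mul_sum]
  apply Finset.sum_le_sum
  intro j _
  rw [sq]
  apply mul_le_mul_of_nonneg_right _ (Finset.sum_nonneg fun i _ => by positivity)
  calc ∑ i ∈ block H j, (1 : ℝ) / q i ≤ ∑ i ∈ block H j, 1 / D := by
        apply Finset.sum_le_sum
        intro i _
        apply one_div_le_one_div_of_le hD
        exact hD0.trans (by exact_mod_cast hq.monotone (Nat.zero_le i))
    _ = H / D := by
        rw [Finset.sum_const, card_block, nsmul_eq_mul]; ring

/-! ### The block estimate (Cauchy–Schwarz) -/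

section Block

variable {F : ℕ → ℂ} {ν : ArithmeticFunction ℂ}

/-- The block sum factors through `(i, y)`, using `ν(qᵢ y) = ν(qᵢ) ν(y)`. [folklore] -/
theorem sum_gSet_eq (hq : StrictMono q) (hν : ν.IsMultiplicative) {J N j : ℕ} (hj : j < J)
    (hp : ∀ i < J * H, (q i).Prime) :
    ∑ m ∈ gSet q H N j, ν m * F m = ∑ y ∈ ySet q H N j, ν y * aFun q H F ν N j y := by
  rw [Finset.sum_image (mul_injOn_tSet hq hj hp)]
  have hmult : ∀ p ∈ tSet q H N j,
      ν (q p.1 * p.2) * F (q p.1 * p.2) = ν p.2 * (ν (q p.1) * F (q p.1 * p.2)) := by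
    rintro ⟨i, y⟩ hiy
    simp only [Finset.mem_filter, Finset.mem_product, Finset.mem_Icc] at hiy
    have hpi := hp i (lt_of_mem_block hj hiy.1.1)
    have hcop : Nat.Coprime (q i) y :=
      (Nat.Prime.coprime_iff_not_dvd hpi).mpr (hiy.1.2.2 i (mem_block.1 hiy.1.1).2)
    dsimp only
    rw [hν.map_mul_of_coprime hcop]; ring
  rw [Finset.sum_congr rfl hmult, Finset.sum_filter, Finset.sum_product_right]
  apply Finset.sum_congr rfl
  intro y _
  rw [Finset.mul_sum]
  apply Finset.sum_congr rfl
  intro i _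
  split_ifs <;> simp

/-- `Y_j ⊆ [1, N]`. [folklore] -/
theorem ySet_subset_Ioc (N j : ℕ) : ySet q H N j ⊆ Finset.Ioc 0 N := by
  intro y hy
  simp only [Finset.mem_filter, Finset.mem_Icc] at hy
  rw [Finset.mem_Ioc]
  exact ⟨hy.1.1, hy.1.2.trans (Nat.div_le_self _ _)⟩

/-- Cauchy–Schwarz: `∑_{y ∈ Y} ‖a y‖ ≤ √#Y √(∑_{y ≤ N} ‖a y‖²)`. [folklore] -/
theorem sum_norm_aFun_le (N j : ℕ) :
    ∑ y ∈ ySet q H N j, ‖aFun q H F ν N j y‖ ≤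
      Real.sqrt ((ySet q H N j).card) *
        Real.sqrt (∑ y ∈ Finset.Ioc 0 N, ‖aFun q H F ν N j y‖ ^ 2) := by
  have h1 : (∑ y ∈ ySet q H N j, ‖aFun q H F ν N j y‖) ^ 2 ≤
      (ySet q H N j).card * ∑ y ∈ ySet q H N j, ‖aFun q H F ν N j y‖ ^ 2 :=
    sq_sum_le_card_mul_sum_sq
  have h2 : ∑ y ∈ ySet q H N j, ‖aFun q H F ν N j y‖ ^ 2 ≤
      ∑ y ∈ Finset.Ioc 0 N, ‖aFun q H F ν N j y‖ ^ 2 :=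
    Finset.sum_le_sum_of_subset_of_nonneg (ySet_subset_Ioc N j) fun _ _ _ => sq_nonneg _
  rw [← Real.sqrt_mul (Nat.cast_nonneg _),
    Real.le_sqrt (Finset.sum_nonneg fun _ _ => norm_nonneg _) (by positivity)]
  exact h1.trans (mul_le_mul_of_nonneg_left h2 (Nat.cast_nonneg _))

/-- `{y ≤ N : qᵢ y ≤ N ∧ qᵢ' y ≤ N} = [1, ⌊N / max(qᵢ, qᵢ')⌋]`. [folklore] -/
theorem filter_eq_Icc {N i i' : ℕ} (hi : 0 < q i) :
    (Finset.Ioc 0 N).filter (fun y => q i * y ≤ N ∧ q i' * y ≤ N) =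
      Finset.Icc 1 (N / max (q i) (q i')) := by
  have hmax : 0 < max (q i) (q i') := lt_max_of_lt_left hi
  ext y
  simp only [Finset.mem_filter, Finset.mem_Ioc, Finset.mem_Icc]
  constructor
  · rintro ⟨⟨hy0, _⟩, h1, h2⟩
    refine ⟨hy0, ?_⟩
    rw [Nat.le_div_iff_mul_le hmax]
    rcases le_total (q i) (q i') with h | h
    · rw [max_eq_right h, mul_comm]; exact h2
    · rw [max_eq_left h, mul_comm]; exact h1
  · rintro ⟨hy0, hy⟩
    rw [Nat.le_div_iff_mul_le hmax] at hy
    have h1 : q i * y ≤ N :=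
      le_trans (by rw [mul_comm]; exact Nat.mul_le_mul_left y (le_max_left _ _)) hy
    have h2 : q i' * y ≤ N :=
      le_trans (by rw [mul_comm]; exact Nat.mul_le_mul_left y (le_max_right _ _)) hy
    exact ⟨⟨hy0, le_trans (Nat.le_mul_of_pos_left y hi) h1⟩, h1, h2⟩

/-- One pair: `‖∑_y c(i,y) conj c(i',y)‖ ≤ ‖corr(N,i,i')‖`. [folklore] -/
theorem norm_sum_cFun_mul_conj_le (hν1 : ∀ n, ‖ν n‖ ≤ 1) {N i i' : ℕ} (hi : 0 < q i) :
    ‖∑ y ∈ Finset.Ioc 0 N, cFun q F ν N i y * conj (cFun q F ν N i' y)‖ ≤ ‖corr q F N i i'‖ := by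
  have hc : ∀ y, cFun q F ν N i y * conj (cFun q F ν N i' y) =
      if (q i * y ≤ N ∧ q i' * y ≤ N) then
        (ν (q i) * conj (ν (q i'))) * (F (q i * y) * conj (F (q i' * y))) else 0 := by
    intro y
    by_cases h1 : q i * y ≤ N <;> by_cases h2 : q i' * y ≤ N <;>
      simp only [h1, h2, if_true, if_false, and_true, and_false,
        map_mul, mul_zero, zero_mul, map_zero]
    ring
  simp_rw [hc]
  rw [← Finset.sum_filter, filter_eq_Icc hi, ← Finset.mul_sum, norm_mul]
  have hν' : ‖ν (q i) * conj (ν (q i'))‖ ≤ 1 := by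
    rw [norm_mul, Complex.norm_conj]
    exact mul_le_one₀ (hν1 _) (norm_nonneg _) (hν1 _)
  exact mul_le_of_le_one_left (norm_nonneg _) hν'

/-- Expanding the square: `∑_{y ≤ N} ‖a(y)‖² ≤ ∑_{i,i'} ‖corr(N,i,i')‖`. [folklore] -/
theorem sum_norm_sq_aFun_le (hν1 : ∀ n, ‖ν n‖ ≤ 1) {N j : ℕ} (hpos : ∀ i ∈ block H j, 0 < q i) :
    ∑ y ∈ Finset.Ioc 0 N, ‖aFun q H F ν N j y‖ ^ 2 ≤
      ∑ i ∈ block H j, ∑ i' ∈ block H j, ‖corr q F N i i'‖ := by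
  have key : ∀ y, (‖aFun q H F ν N j y‖ ^ 2 : ℝ) =
      (∑ i ∈ block H j, ∑ i' ∈ block H j, cFun q F ν N i y * conj (cFun q F ν N i' y)).re := by
    intro y
    rw [← Finset.sum_mul_sum, ← map_sum, Complex.mul_conj, Complex.ofReal_re,
      Complex.normSq_eq_norm_sq]
  calc ∑ y ∈ Finset.Ioc 0 N, ‖aFun q H F ν N j y‖ ^ 2
      = ∑ y ∈ Finset.Ioc 0 N, (∑ i ∈ block H j, ∑ i' ∈ block H j,
          cFun q F ν N i y * conj (cFun q F ν N i' y)).re := Finset.sum_congr rfl fun y _ => key y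
    _ = (∑ y ∈ Finset.Ioc 0 N, ∑ i ∈ block H j, ∑ i' ∈ block H j,
          cFun q F ν N i y * conj (cFun q F ν N i' y)).re := (Complex.re_sum _ _).symm
    _ = (∑ i ∈ block H j, ∑ i' ∈ block H j, ∑ y ∈ Finset.Ioc 0 N,
          cFun q F ν N i y * conj (cFun q F ν N i' y)).re := by
        rw [Finset.sum_comm]
        congr 1
        apply Finset.sum_congr rfl
        intro i _
        rw [Finset.sum_comm]
    _ ≤ ‖∑ i ∈ block H j, ∑ i' ∈ block H j, ∑ y ∈ Finset.Ioc 0 N,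
          cFun q F ν N i y * conj (cFun q F ν N i' y)‖ := Complex.re_le_norm _
    _ ≤ ∑ i ∈ block H j, ‖∑ i' ∈ block H j, ∑ y ∈ Finset.Ioc 0 N,
          cFun q F ν N i y * conj (cFun q F ν N i' y)‖ := norm_sum_le _ _
    _ ≤ ∑ i ∈ block H j, ∑ i' ∈ block H j, ‖∑ y ∈ Finset.Ioc 0 N,
          cFun q F ν N i y * conj (cFun q F ν N i' y)‖ :=
        Finset.sum_le_sum fun i _ => norm_sum_le _ _
    _ ≤ ∑ i ∈ block H j, ∑ i' ∈ block H j, ‖corr q F N i i'‖ :=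
        Finset.sum_le_sum fun i hi => Finset.sum_le_sum fun i' _ =>
          norm_sum_cFun_mul_conj_le hν1 (hpos i hi)

/-- Diagonal + off-diagonal: `∑_{i,i' ∈ block j} ‖corr‖ ≤ N L_j (1 + τ H)`. [folklore] -/
theorem sum_corr_le (hF : ∀ n, ‖F n‖ ≤ 1) {τ : ℝ} (hτ : 0 ≤ τ) {J N j : ℕ} (hj : j < J)
    (hp : ∀ i < J * H, (q i).Prime)
    (hE : ∀ i ∈ Finset.range (J * H), ∀ i' ∈ Finset.range (J * H), i ≠ i' →
      ‖corr q F N i i'‖ ≤ τ * ((N / max (q i) (q i') : ℕ) : ℝ)) :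
    ∑ i ∈ block H j, ∑ i' ∈ block H j, ‖corr q F N i i'‖ ≤
      N * (∑ i ∈ block H j, (1 : ℝ) / q i) * (1 + τ * H) := by
  have hdiag : ∀ i ∈ block H j, ‖corr q F N i i‖ ≤ (N : ℝ) / q i := by
    intro i hi
    have hqi := (hp i (lt_of_mem_block hj hi)).pos
    calc ‖corr q F N i i‖
        ≤ ∑ y ∈ Finset.Icc 1 (N / max (q i) (q i)), ‖F (q i * y) * conj (F (q i * y))‖ :=
          norm_sum_le _ _
      _ ≤ ∑ y ∈ Finset.Icc 1 (N / max (q i) (q i)), (1 : ℝ) := by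
          apply Finset.sum_le_sum
          intro y _
          rw [norm_mul, Complex.norm_conj]
          exact mul_le_one₀ (hF _) (norm_nonneg _) (hF _)
      _ = ((N / q i : ℕ) : ℝ) := by
          rw [Finset.sum_const, Nat.card_Icc, max_self, nsmul_eq_mul, mul_one, Nat.add_sub_cancel]
      _ ≤ (N : ℝ) / q i := Nat.cast_div_le
  have hoff : ∀ i ∈ block H j, ∀ i' ∈ block H j, i ≠ i' → ‖corr q F N i i'‖ ≤ τ * N / q i := by
    intro i hi i' hi' hne
    have hqi := (hp i (lt_of_mem_block hj hi)).pos
    calc ‖corr q F N i i'‖ ≤ τ * ((N / max (q i) (q i') : ℕ) : ℝ) :=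
          hE i (Finset.mem_range.2 (lt_of_mem_block hj hi)) i'
            (Finset.mem_range.2 (lt_of_mem_block hj hi')) hne
      _ ≤ τ * ((N : ℝ) / q i) := by
          apply mul_le_mul_of_nonneg_left _ hτ
          refine Nat.cast_div_le.trans ?_
          push_cast
          apply div_le_div_of_nonneg_left (Nat.cast_nonneg _) (by exact_mod_cast hqi)
          exact_mod_cast le_max_left (q i) (q i')
      _ = τ * N / q i := by ring
  have hboth : ∀ i ∈ block H j, ∀ i' ∈ block H j,
      ‖corr q F N i i'‖ ≤ (if i = i' then (N : ℝ) / q i else 0) + τ * N / q i := by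
    intro i hi i' hi'
    have hnn : 0 ≤ τ * N / q i := by positivity
    by_cases h : i = i'
    · subst h
      simp only [if_true]
      linarith [hdiag i hi]
    · simp only [h, if_false, zero_add]
      exact hoff i hi i' hi' h
  calc ∑ i ∈ block H j, ∑ i' ∈ block H j, ‖corr q F N i i'‖
      ≤ ∑ i ∈ block H j, ∑ i' ∈ block H j,
          ((if i = i' then (N : ℝ) / q i else 0) + τ * N / q i) :=
        Finset.sum_le_sum fun i hi => Finset.sum_le_sum fun i' hi' => hboth i hi i' hi'
    _ = ∑ i ∈ block H j, ((N : ℝ) / q i + H * (τ * N / q i)) := by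
        apply Finset.sum_congr rfl
        intro i hi
        rw [Finset.sum_add_distrib, Finset.sum_ite_eq, if_pos hi, Finset.sum_const, card_block,
          nsmul_eq_mul]
    _ = N * (∑ i ∈ block H j, (1 : ℝ) / q i) * (1 + τ * H) := by
        rw [Finset.mul_sum, Finset.sum_mul]
        apply Finset.sum_congr rfl
        intro i _
        ring

/-- The estimate for one block: `‖∑_{m ∈ G_j} ν F‖ ≤ √#Y_j · √(N L_j (1 + τH))`. [folklore] -/
theorem norm_sum_gSet_le (hF : ∀ n, ‖F n‖ ≤ 1) (hν : ν.IsMultiplicative) (hν1 : ∀ n, ‖ν n‖ ≤ 1)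
    (hq : StrictMono q) {τ : ℝ} (hτ : 0 ≤ τ) {J N j : ℕ} (hj : j < J)
    (hp : ∀ i < J * H, (q i).Prime)
    (hE : ∀ i ∈ Finset.range (J * H), ∀ i' ∈ Finset.range (J * H), i ≠ i' →
      ‖corr q F N i i'‖ ≤ τ * ((N / max (q i) (q i') : ℕ) : ℝ)) :
    ‖∑ m ∈ gSet q H N j, ν m * F m‖ ≤
      Real.sqrt ((ySet q H N j).card) *
        Real.sqrt (N * (∑ i ∈ block H j, (1 : ℝ) / q i) * (1 + τ * H)) := by
  rw [sum_gSet_eq hq hν hj hp]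
  have hpos : ∀ i ∈ block H j, 0 < q i := fun i hi => (hp i (lt_of_mem_block hj hi)).pos
  calc ‖∑ y ∈ ySet q H N j, ν y * aFun q H F ν N j y‖
      ≤ ∑ y ∈ ySet q H N j, ‖ν y * aFun q H F ν N j y‖ := norm_sum_le _ _
    _ ≤ ∑ y ∈ ySet q H N j, ‖aFun q H F ν N j y‖ := by
        apply Finset.sum_le_sum
        intro y _
        rw [norm_mul]
        exact mul_le_of_le_one_left (norm_nonneg _) (hν1 y)
    _ ≤ Real.sqrt ((ySet q H N j).card) *
          Real.sqrt (∑ y ∈ Finset.Ioc 0 N, ‖aFun q H F ν N j y‖ ^ 2) := sum_norm_aFun_le N j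
    _ ≤ Real.sqrt ((ySet q H N j).card) *
          Real.sqrt (N * (∑ i ∈ block H j, (1 : ℝ) / q i) * (1 + τ * H)) := by
        apply mul_le_mul_of_nonneg_left _ (Real.sqrt_nonneg _)
        apply Real.sqrt_le_sqrt
        exact (sum_norm_sq_aFun_le hν1 hpos).trans (sum_corr_le hF hτ hj hp hE)

end Block


/-! ### Summing over the blocks -/

section Sum

variable {F : ℕ → ℂ} {ν : ArithmeticFunction ℂ}

/-- `H #Y_j ≤ #T_j + H (⌊N/m_j⌋ - ⌊N/M_j⌋)`, `m_j, M_j` the extreme primes of block `j`.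
[folklore] -/
theorem card_ySet_le (hq : StrictMono q) {N j : ℕ} :
    H * (ySet q H N j).card ≤
      (tSet q H N j).card + H * (N / q (j * H) - N / q (j * H + (H - 1))) := by
  set M := q (j * H + (H - 1)) with hMdef
  set Y := ySet q H N j with hYdef
  have hsplit := Finset.card_filter_add_card_filter_not (s := Y) (fun y => y ≤ N / M)
  have h1 : H * (Y.filter (fun y => y ≤ N / M)).card ≤ (tSet q H N j).card := by
    calc H * (Y.filter (fun y => y ≤ N / M)).card
        = (block H j ×ˢ Y.filter (fun y => y ≤ N / M)).card := by
          rw [Finset.card_product, card_block]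
      _ ≤ (tSet q H N j).card := by
          apply Finset.card_le_card
          rintro ⟨i, y⟩ hiy
          simp only [hYdef, Finset.mem_product, Finset.mem_filter] at hiy
          simp only [Finset.mem_filter, Finset.mem_product]
          refine ⟨⟨hiy.1, hiy.2.1⟩, ?_⟩
          have hiM : q i ≤ M := hq.monotone (by have := mem_block.1 hiy.1; omega)
          calc q i * y ≤ M * (N / M) := Nat.mul_le_mul hiM hiy.2.2
            _ ≤ N := Nat.mul_div_le N M
  have h2 : (Y.filter (fun y => ¬ y ≤ N / M)).card ≤ N / q (j * H) - N / M := by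
    rw [← Nat.card_Ioc]
    apply Finset.card_le_card
    intro y hy
    rw [Finset.mem_filter] at hy
    have hyY := hy.1
    simp only [hYdef, Finset.mem_filter, Finset.mem_Icc] at hyY
    rw [Finset.mem_Ioc]
    exact ⟨not_le.mp hy.2, hyY.1.2⟩
  calc H * Y.card = H * (Y.filter (fun y => y ≤ N / M)).card +
        H * (Y.filter (fun y => ¬ y ≤ N / M)).card := by rw [← mul_add, hsplit]
    _ ≤ (tSet q H N j).card + H * (N / q (j * H) - N / M) :=
        add_le_add h1 (Nat.mul_le_mul_left H h2)

/-- Real form: `H #Y_j ≤ #G_j + H (N (1/m_j - 1/M_j) + 1)`. [folklore] -/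
theorem card_ySet_le_real (hq : StrictMono q) (hH : 0 < H) {J N j : ℕ} (hj : j < J)
    (hp : ∀ i < J * H, (q i).Prime) :
    (H : ℝ) * (ySet q H N j).card ≤
      (gSet q H N j).card +
        H * (N * (1 / (q (j * H) : ℝ) - 1 / q (j * H + (H - 1))) + 1) := by
  have h := card_ySet_le (H := H) hq (N := N) (j := j)
  rw [← card_gSet hq hj hp] at h
  have hjH : j * H + (H - 1) < J * H := by have := succ_mul_le (H := H) hj; omega
  have hm : 0 < q (j * H) := (hp _ (lt_of_le_of_lt (by omega) hjH)).pos
  have hM : 0 < q (j * H + (H - 1)) := (hp _ hjH).pos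
  have hmM : q (j * H) ≤ q (j * H + (H - 1)) := hq.monotone (Nat.le_add_right _ _)
  have hdiv : N / q (j * H + (H - 1)) ≤ N / q (j * H) := Nat.div_le_div_left hmM hm
  have hcast : ((H * (ySet q H N j).card : ℕ) : ℝ) ≤
      ((gSet q H N j).card : ℝ) +
        H * (((N / q (j * H) : ℕ) : ℝ) - ((N / q (j * H + (H - 1)) : ℕ) : ℝ)) := by
    have := h
    rw [← Nat.cast_sub hdiv]
    exact_mod_cast this
  have hup : ((N / q (j * H) : ℕ) : ℝ) ≤ N / q (j * H) := Nat.cast_div_le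
  have hMr : (0 : ℝ) < q (j * H + (H - 1)) := by exact_mod_cast hM
  have hlow : (N : ℝ) / q (j * H + (H - 1)) - 1 ≤ ((N / q (j * H + (H - 1)) : ℕ) : ℝ) := by
    have h' : (N : ℝ) < ((N / q (j * H + (H - 1)) : ℕ) : ℝ) * q (j * H + (H - 1)) +
        q (j * H + (H - 1)) := by exact_mod_cast Nat.lt_div_mul_add (a := N) hM
    rw [sub_le_iff_le_add, div_le_iff₀ hMr]
    linarith
  push_cast at hcast
  have hH0 : (0 : ℝ) ≤ H := Nat.cast_nonneg H
  calc (H : ℝ) * (ySet q H N j).card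
      ≤ (gSet q H N j).card +
          H * (((N / q (j * H) : ℕ) : ℝ) - ((N / q (j * H + (H - 1)) : ℕ) : ℝ)) := hcast
    _ ≤ (gSet q H N j).card + H * ((N : ℝ) / q (j * H) - ((N : ℝ) / q (j * H + (H - 1)) - 1)) := by
        gcongr
    _ = _ := by ring

/-- `∑_j H #Y_j ≤ N + H N / D + H J`. [folklore] -/
theorem sum_card_ySet_le (hq : StrictMono q) (hH : 0 < H) {J N : ℕ}
    (hp : ∀ i < J * H, (q i).Prime) {D : ℝ} (hD : 0 < D) (hD0 : D ≤ q 0) :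
    ∑ j ∈ Finset.range J, (H : ℝ) * (ySet q H N j).card ≤ N + H * N / D + H * J := by
  classical
  have hG : ∑ j ∈ Finset.range J, ((gSet q H N j).card : ℝ) ≤ N := by
    have h1 : ∑ j ∈ Finset.range J, (gSet q H N j).card =
        ((Finset.range J).biUnion (fun j => gSet q H N j)).card := by
      rw [Finset.card_biUnion]
      intro j hj j' hj' hne
      exact gSet_disjoint hq (Finset.mem_range.1 hj) (Finset.mem_range.1 hj') hne hp
    have h2 : ((Finset.range J).biUnion (fun j => gSet q H N j)).card ≤ (Finset.Ioc 0 N).card :=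
      Finset.card_le_card (Finset.biUnion_subset.2 fun j hj =>
        gSet_subset_Ioc (Finset.mem_range.1 hj) hp)
    rw [Nat.card_Ioc, Nat.sub_zero] at h2
    exact_mod_cast h1 ▸ h2
  have htel : ∑ j ∈ Finset.range J, (1 / (q (j * H) : ℝ) - 1 / q (j * H + (H - 1))) ≤ 1 / D := by
    calc ∑ j ∈ Finset.range J, (1 / (q (j * H) : ℝ) - 1 / q (j * H + (H - 1)))
        ≤ ∑ j ∈ Finset.range J, (1 / (q (j * H) : ℝ) - 1 / q ((j + 1) * H)) := by
          apply Finset.sum_le_sum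
          intro j hj
          have hj' := Finset.mem_range.1 hj
          have hjH : j * H + (H - 1) < J * H := by have := succ_mul_le (H := H) hj'; omega
          have hM : 0 < q (j * H + (H - 1)) := (hp _ hjH).pos
          have hle : q (j * H + (H - 1)) ≤ q ((j + 1) * H) :=
            hq.monotone (by rw [add_one_mul]; omega)
          have : (1 / (q ((j + 1) * H)) : ℝ) ≤ 1 / q (j * H + (H - 1)) :=
            one_div_le_one_div_of_le (by exact_mod_cast hM) (by exact_mod_cast hle)
          linarith
      _ = 1 / q 0 - 1 / q (J * H) := by
          rw [Finset.sum_range_sub' (fun j => 1 / (q (j * H) : ℝ))]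
          simp
      _ ≤ 1 / q 0 := by
          have : (0 : ℝ) ≤ 1 / q (J * H) := by positivity
          linarith
      _ ≤ 1 / D := one_div_le_one_div_of_le hD hD0
  calc ∑ j ∈ Finset.range J, (H : ℝ) * (ySet q H N j).card
      ≤ ∑ j ∈ Finset.range J, (((gSet q H N j).card : ℝ) +
          H * (N * (1 / (q (j * H) : ℝ) - 1 / q (j * H + (H - 1))) + 1)) :=
        Finset.sum_le_sum fun j hj => card_ySet_le_real hq hH (Finset.mem_range.1 hj) hp
    _ = ∑ j ∈ Finset.range J, ((gSet q H N j).card : ℝ) +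
          H * N * ∑ j ∈ Finset.range J, (1 / (q (j * H) : ℝ) - 1 / q (j * H + (H - 1))) +
          H * J := by
        have e : ∀ j ∈ Finset.range J, ((gSet q H N j).card : ℝ) +
            H * (N * (1 / (q (j * H) : ℝ) - 1 / q (j * H + (H - 1))) + 1) =
            (gSet q H N j).card +
              (H * N * (1 / (q (j * H) : ℝ) - 1 / q (j * H + (H - 1))) + H) := fun j _ => by ring
        rw [Finset.sum_congr rfl e, Finset.sum_add_distrib, Finset.sum_add_distrib,
          ← Finset.mul_sum, Finset.sum_const, Finset.card_range, nsmul_eq_mul]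
        ring
    _ ≤ N + H * N * (1 / D) + H * J := by gcongr
    _ = N + H * N / D + H * J := by ring

/-- `√a √b = √(ca) √(b/c)` for `c > 0`. [folklore] -/
theorem sqrt_mul_sqrt_eq {a b c : ℝ} (ha : 0 ≤ a) (hc : 0 < c) :
    Real.sqrt a * Real.sqrt b = Real.sqrt (c * a) * Real.sqrt (b / c) := by
  rw [← Real.sqrt_mul ha, ← Real.sqrt_mul (by positivity)]
  congr 1
  field_simp

/-- The estimate for fixed `N`, on the event that (1.3) holds at all `M = ⌊N/max(qᵢ,qᵢ')⌋`:
`‖∑_{m ≤ N} ν F‖ ≤ √(N + HN/D + HJ) √(N L (1/H + τ)) + (N + Q) e^{-L} + N (H/D) L`. [folklore] -/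
theorem norm_sum_le_of_goodN (hF : ∀ n, ‖F n‖ ≤ 1) (hν : ν.IsMultiplicative)
    (hν1 : ∀ n, ‖ν n‖ ≤ 1) (hq : StrictMono q) (hH : 0 < H) {τ : ℝ} (hτ : 0 ≤ τ) {J N : ℕ}
    (hp : ∀ i < J * H, (q i).Prime) {D : ℝ} (hD : 0 < D) (hD0 : D ≤ q 0)
    (hE : ∀ i ∈ Finset.range (J * H), ∀ i' ∈ Finset.range (J * H), i ≠ i' →
      ‖corr q F N i i'‖ ≤ τ * ((N / max (q i) (q i') : ℕ) : ℝ)) :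
    ‖∑ m ∈ Finset.Ioc 0 N, ν m * F m‖ ≤
      Real.sqrt (N + H * N / D + H * J) *
          Real.sqrt (N * (∑ i ∈ Finset.range (J * H), (1 : ℝ) / q i) * (1 / H + τ)) +
        (N + ∏ i ∈ Finset.range (J * H), (q i : ℝ)) *
          Real.exp (-∑ i ∈ Finset.range (J * H), (1 : ℝ) / q i) +
        N * (H / D * ∑ i ∈ Finset.range (J * H), (1 : ℝ) / q i) := by
  classical
  set L := ∑ i ∈ Finset.range (J * H), (1 : ℝ) / q i with hLdef
  set U := (Finset.range J).biUnion (fun j => gSet q H N j) with hUdef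
  have hU : U ⊆ Finset.Ioc 0 N :=
    Finset.biUnion_subset.2 fun j hj => gSet_subset_Ioc (Finset.mem_range.1 hj) hp
  have hHr : (0 : ℝ) < H := by exact_mod_cast hH
  -- the exceptional part
  have hexc : ‖∑ m ∈ Finset.Ioc 0 N \ U, ν m * F m‖ ≤
      ((sifted q (J * H) N).card : ℝ) + (bad q H J N).card := by
    calc ‖∑ m ∈ Finset.Ioc 0 N \ U, ν m * F m‖
        ≤ ∑ m ∈ Finset.Ioc 0 N \ U, ‖ν m * F m‖ := norm_sum_le _ _
      _ ≤ ∑ m ∈ Finset.Ioc 0 N \ U, (1 : ℝ) := by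
          apply Finset.sum_le_sum
          intro m _
          rw [norm_mul]
          exact mul_le_one₀ (hν1 m) (norm_nonneg _) (hF m)
      _ = ((Finset.Ioc 0 N \ U).card : ℝ) := by simp
      _ ≤ ((sifted q (J * H) N ∪ bad q H J N).card : ℝ) := by
          have hsub : Finset.Ioc 0 N \ U ⊆ sifted q (J * H) N ∪ bad q H J N := by
            intro m hm
            rw [Finset.mem_sdiff] at hm
            have := Ioc_subset_union hq hH hp hm.1
            simp only [Finset.mem_union] at this ⊢
            rcases this with (h | h) | h
            · exact absurd h hm.2
            · exact Or.inl h
            · exact Or.inr h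
          exact_mod_cast Finset.card_le_card hsub
      _ ≤ _ := by exact_mod_cast Finset.card_union_le _ _
  -- the structured part
  have hmain : ‖∑ m ∈ U, ν m * F m‖ ≤
      Real.sqrt (N + H * N / D + H * J) * Real.sqrt (N * L * (1 / H + τ)) := by
    rw [hUdef, Finset.sum_biUnion (fun j hj j' hj' hne =>
      gSet_disjoint hq (Finset.mem_range.1 hj) (Finset.mem_range.1 hj') hne hp)]
    calc ‖∑ j ∈ Finset.range J, ∑ m ∈ gSet q H N j, ν m * F m‖
        ≤ ∑ j ∈ Finset.range J, ‖∑ m ∈ gSet q H N j, ν m * F m‖ := norm_sum_le _ _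
      _ ≤ ∑ j ∈ Finset.range J, Real.sqrt ((ySet q H N j).card) *
            Real.sqrt (N * (∑ i ∈ block H j, (1 : ℝ) / q i) * (1 + τ * H)) :=
          Finset.sum_le_sum fun j hj =>
            norm_sum_gSet_le hF hν hν1 hq hτ (Finset.mem_range.1 hj) hp hE
      _ = ∑ j ∈ Finset.range J, Real.sqrt (H * (ySet q H N j).card) *
            Real.sqrt (N * (∑ i ∈ block H j, (1 : ℝ) / q i) * (1 + τ * H) / H) :=
          Finset.sum_congr rfl fun j _ =>
            sqrt_mul_sqrt_eq (Nat.cast_nonneg _) hHr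
      _ ≤ Real.sqrt (∑ j ∈ Finset.range J, (H : ℝ) * (ySet q H N j).card) *
            Real.sqrt (∑ j ∈ Finset.range J,
              N * (∑ i ∈ block H j, (1 : ℝ) / q i) * (1 + τ * H) / H) :=
          Real.sum_sqrt_mul_sqrt_le _ (fun j => by positivity) (fun j => by positivity)
      _ ≤ Real.sqrt (N + H * N / D + H * J) * Real.sqrt (N * L * (1 / H + τ)) := by
          apply mul_le_mul (Real.sqrt_le_sqrt (sum_card_ySet_le hq hH hp hD hD0)) _
            (Real.sqrt_nonneg _) (Real.sqrt_nonneg _)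
          apply Real.sqrt_le_sqrt
          rw [← Finset.sum_div, ← Finset.sum_mul, ← Finset.mul_sum, sum_blocks_eq, ← hLdef]
          apply le_of_eq
          field_simp
  have hsift := card_sifted_le hq (N := N) hp
  have hbad : ((bad q H J N).card : ℝ) ≤ N * (H / D * L) :=
    (card_bad_le J N).trans (mul_le_mul_of_nonneg_left (sum_sq_le hq hD hD0 J) (Nat.cast_nonneg N))
  calc ‖∑ m ∈ Finset.Ioc 0 N, ν m * F m‖
      = ‖∑ m ∈ Finset.Ioc 0 N \ U, ν m * F m + ∑ m ∈ U, ν m * F m‖ := by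
        rw [Finset.sum_sdiff hU]
    _ ≤ ‖∑ m ∈ Finset.Ioc 0 N \ U, ν m * F m‖ + ‖∑ m ∈ U, ν m * F m‖ := norm_add_le _ _
    _ ≤ (((sifted q (J * H) N).card : ℝ) + (bad q H J N).card) +
          Real.sqrt (N + H * N / D + H * J) * Real.sqrt (N * L * (1 / H + τ)) :=
        add_le_add hexc hmain
    _ ≤ _ := by linarith

/-- The pair hypothesis (1.3) eventually holds simultaneously at all `M = ⌊N/max(qᵢ,qᵢ')⌋`.
[folklore] -/
theorem eventually_goodN {τ : ℝ} {J : ℕ} (hpos : ∀ i < J * H, 0 < q i)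
    (hcorr : ∀ i < J * H, ∀ i' < J * H, i ≠ i' → ∀ᶠ M : ℕ in atTop,
      ‖∑ m ∈ Finset.Icc 1 M, F (q i * m) * conj (F (q i' * m))‖ ≤ τ * M) :
    ∀ᶠ N : ℕ in atTop, ∀ i ∈ Finset.range (J * H), ∀ i' ∈ Finset.range (J * H), i ≠ i' →
        ‖corr q F N i i'‖ ≤ τ * ((N / max (q i) (q i') : ℕ) : ℝ) := by
  rw [Finset.eventually_all]
  intro i hi
  rw [Finset.eventually_all]
  intro i' hi'
  by_cases hne : i = i'
  · exact Filter.Eventually.of_forall fun N h => absurd hne h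
  · have hi1 := Finset.mem_range.1 hi
    have hi'1 := Finset.mem_range.1 hi'
    have hc : 0 < max (q i) (q i') := lt_max_of_lt_left (hpos i hi1)
    have ht : Tendsto (fun N : ℕ => N / max (q i) (q i')) atTop atTop := by
      rw [Filter.tendsto_atTop_atTop]
      intro b
      exact ⟨b * max (q i) (q i'), fun N hN => (Nat.le_div_iff_mul_le hc).2 hN⟩
    have := ht.eventually (hcorr i hi1 i' hi'1 hne)
    exact this.mono fun N hN _ => hN

/-- **The block estimate** (the abstract form of BSZ §2): for every `δ > 0`, eventually in `N`,
`‖∑_{n ≤ N} ν(n) F(n)‖ ≤ (√((1 + H/D) L (1/H + τ)) + e^{-L} + (H/D) L + δ) N`. [folklore] -/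
theorem eventually_norm_sum_le (hF : ∀ n, ‖F n‖ ≤ 1) (hν : ν.IsMultiplicative)
    (hν1 : ∀ n, ‖ν n‖ ≤ 1) (hq : StrictMono q) (hH : 0 < H) {τ : ℝ} (hτ : 0 ≤ τ) {J : ℕ}
    (hp : ∀ i < J * H, (q i).Prime) {D : ℝ} (hD : 0 < D) (hD0 : D ≤ q 0)
    (hcorr : ∀ i < J * H, ∀ i' < J * H, i ≠ i' → ∀ᶠ M : ℕ in atTop,
      ‖∑ m ∈ Finset.Icc 1 M, F (q i * m) * conj (F (q i' * m))‖ ≤ τ * M)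
    {δ : ℝ} (hδ : 0 < δ) :
    ∀ᶠ N : ℕ in atTop, ‖∑ m ∈ Finset.Icc 1 N, ν m * F m‖ ≤
      (Real.sqrt ((1 + H / D) * (∑ i ∈ Finset.range (J * H), (1 : ℝ) / q i) * (1 / H + τ)) +
        Real.exp (-∑ i ∈ Finset.range (J * H), (1 : ℝ) / q i) +
        H / D * (∑ i ∈ Finset.range (J * H), (1 : ℝ) / q i) + δ) * N := by
  set L := ∑ i ∈ Finset.range (J * H), (1 : ℝ) / q i with hLdef
  set Q := ∏ i ∈ Finset.range (J * H), (q i : ℝ) with hQdef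
  have hL0 : 0 ≤ L := Finset.sum_nonneg fun i _ => by positivity
  have hHr : (0 : ℝ) < H := by exact_mod_cast hH
  set c := L * (1 / H + τ) with hcdef
  have hc0 : 0 ≤ c := by positivity
  set b := (H : ℝ) * J with hbdef
  have hb0 : 0 ≤ b := by positivity
  have hE := eventually_goodN (H := H) (F := F) (τ := τ) (fun i hi => (hp i hi).pos) hcorr
  have h1 := (tendsto_natCast_atTop_atTop (R := ℝ)).eventually_ge_atTop (4 * b * c / δ ^ 2)
  have h2 := (tendsto_natCast_atTop_atTop (R := ℝ)).eventually_ge_atTop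
    (2 * Q * Real.exp (-L) / δ)
  filter_upwards [hE, h1, h2] with N hN hN1 hN2
  have hN0 : (0 : ℝ) ≤ N := Nat.cast_nonneg N
  have main := norm_sum_le_of_goodN hF hν hν1 hq hH hτ hp hD hD0 hN
  rw [show Finset.Icc 1 N = Finset.Ioc 0 N by
    ext m; simp only [Finset.mem_Icc, Finset.mem_Ioc]; omega]
  refine main.trans ?_
  rw [← hLdef, ← hQdef]
  -- the square-root term
  have hsq : Real.sqrt (N + H * N / D + H * J) * Real.sqrt (N * L * (1 / H + τ)) ≤
      Real.sqrt ((1 + H / D) * L * (1 / H + τ)) * N + δ / 2 * N := by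
    have e1 : (N : ℝ) + H * N / D + H * J = (1 + H / D) * N + b := by rw [hbdef]; ring
    have e2 : (N : ℝ) * L * (1 / H + τ) = N * c := by rw [hcdef]; ring
    rw [e1, e2]
    have hs : Real.sqrt ((1 + H / D) * N + b) ≤ Real.sqrt ((1 + H / D) * N) + Real.sqrt b := by
      have hx : (0 : ℝ) ≤ (1 + H / D) * N := by positivity
      rw [Real.sqrt_le_left (by positivity)]
      nlinarith [Real.sq_sqrt hx, Real.sq_sqrt hb0, Real.sqrt_nonneg ((1 + H / D) * N),
        Real.sqrt_nonneg b]
    calc Real.sqrt ((1 + H / D) * N + b) * Real.sqrt (N * c)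
        ≤ (Real.sqrt ((1 + H / D) * N) + Real.sqrt b) * Real.sqrt (N * c) :=
          mul_le_mul_of_nonneg_right hs (Real.sqrt_nonneg _)
      _ = Real.sqrt ((1 + H / D) * N) * Real.sqrt (N * c) + Real.sqrt b * Real.sqrt (N * c) := by
          ring
      _ ≤ Real.sqrt ((1 + H / D) * L * (1 / H + τ)) * N + δ / 2 * N := by
          apply add_le_add
          · rw [← Real.sqrt_mul (by positivity),
              show (1 + (H : ℝ) / D) * N * (N * c) = ((1 + H / D) * L * (1 / H + τ)) * (N * N) by
                rw [hcdef]; ring,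
              Real.sqrt_mul (by positivity), Real.sqrt_mul_self hN0]
          · rw [← Real.sqrt_mul hb0, Real.sqrt_le_left (by positivity)]
            have : b * c ≤ δ ^ 2 / 4 * N := by
              have := hN1
              rw [div_le_iff₀ (by positivity)] at this
              linarith
            nlinarith
  -- the sifted term
  have hsf : ((N : ℝ) + Q) * Real.exp (-L) ≤ Real.exp (-L) * N + δ / 2 * N := by
    have : Q * Real.exp (-L) ≤ δ / 2 * N := by
      have := hN2
      rw [div_le_iff₀ hδ] at this
      linarith
    nlinarith [Real.exp_pos (-L)]
  nlinarith [hsq, hsf]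

end Sum


/-! ### The numerical endgame -/

section Endgame

/-- `441 log u ≤ u` for `u ≥ 810000` (crude). [folklore] -/
theorem log_mul_le {u : ℝ} (hu : 810000 ≤ u) : 441 * Real.log u ≤ u := by
  have hu0 : 0 < u := by linarith
  have h1 : Real.log u ≤ 2 * Real.sqrt u := by
    have e1 : Real.log (Real.sqrt u) = Real.log u / 2 := Real.log_sqrt hu0.le
    have e2 : Real.log (Real.sqrt u) ≤ Real.sqrt u - 1 :=
      Real.log_le_sub_one_of_pos (Real.sqrt_pos.2 hu0)
    linarith
  have h2 : (882 : ℝ) ≤ Real.sqrt u := by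
    rw [Real.le_sqrt (by norm_num) hu0.le]; nlinarith
  have h3 : Real.sqrt u * Real.sqrt u = u := Real.mul_self_sqrt hu0.le
  nlinarith [Real.sqrt_nonneg u]

/-- `(2u)^10 ≤ e^u` for `u ≥ 810000` (crude). [folklore] -/
theorem pow_le_exp {u : ℝ} (hu : 810000 ≤ u) : (2 * u) ^ 10 ≤ Real.exp u := by
  have hu0 : 0 < u := by linarith
  have h1 : Real.log u ≤ 2 * Real.sqrt u := by
    have e1 : Real.log (Real.sqrt u) = Real.log u / 2 := Real.log_sqrt hu0.le
    have e2 : Real.log (Real.sqrt u) ≤ Real.sqrt u - 1 :=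
      Real.log_le_sub_one_of_pos (Real.sqrt_pos.2 hu0)
    linarith
  have h2 : (21 : ℝ) ≤ Real.sqrt u := by
    rw [Real.le_sqrt (by norm_num) hu0.le]; nlinarith
  have h3 : Real.sqrt u * Real.sqrt u = u := Real.mul_self_sqrt hu0.le
  have hlog2 : Real.log 2 ≤ 1 := by
    have := Real.log_le_sub_one_of_pos (x := 2) (by norm_num); linarith
  have h4 : 10 * Real.log (2 * u) ≤ u := by
    rw [Real.log_mul (by norm_num) hu0.ne']
    nlinarith [Real.sqrt_nonneg u]
  calc (2 * u) ^ 10 = Real.exp (10 * Real.log (2 * u)) := by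
        rw [show (10 : ℝ) * Real.log (2 * u) = ((10 : ℕ) : ℝ) * Real.log (2 * u) by norm_num,
          Real.exp_nat_mul, Real.exp_log (by linarith)]
    _ ≤ Real.exp u := Real.exp_le_exp.2 h4

/-- The numerical endgame: with `τ = 1/u`, `u ≤ k ≤ u + 1`, `log u ≥ 64` and
`log u - log(10 log k) - 6/(10 log k) - k⁻⁸ ≤ L ≤ log u + 4`, the constant of the block estimate
(blocks of `H = k²` primes `> D = k¹⁰`) satisfies
`√((1 + H/D) L (1/H + τ)) + e^{-L} + (H/D) L ≤ (11/10 + 1/2 + 1/10) √(τ log u) < 2 √(τ log(1/τ))`.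
[folklore] -/
theorem endgame {u k L : ℝ} (hu : 810000 ≤ u) (hℓ : 64 ≤ Real.log u) (hk : u ≤ k)
    (hk1 : k ≤ u + 1) (hL0 : 0 ≤ L) (hL1 : L ≤ Real.log u + 4)
    (hL2 : Real.log u - Real.log (10 * Real.log k) - 6 / (10 * Real.log k) - k ^ 2 / k ^ 10 ≤ L) :
    Real.sqrt ((1 + k ^ 2 / k ^ 10) * L * (1 / k ^ 2 + 1 / u)) + Real.exp (-L) +
      k ^ 2 / k ^ 10 * L < 2 * Real.sqrt (1 / u * Real.log u) := by
  set ℓ := Real.log u with hℓdef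
  set τ := 1 / u with hτdef
  have hu0 : 0 < u := by linarith
  have hτ0 : 0 < τ := by positivity
  have hτ1 : τ ≤ 1 / 810000 := one_div_le_one_div_of_le (by norm_num) hu
  have hk0 : 0 < k := by linarith
  have hk1' : 1 ≤ k := by linarith
  have hℓ0 : 0 < ℓ := by linarith
  set s := Real.sqrt (τ * ℓ) with hsdef
  have hs0 : 0 < s := Real.sqrt_pos.2 (by positivity)
  have hss : s * s = τ * ℓ := Real.mul_self_sqrt (by positivity)
  -- `τ ℓ ≤ 1/441`
  have htl : τ * ℓ ≤ 1 / 441 := by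
    have := log_mul_le hu
    rw [hτdef, one_div_mul_eq_div, div_le_div_iff₀ hu0 (by norm_num)]
    linarith
  -- A = k²/k¹⁰ ≤ τ⁸ ≤ τ
  have hA : k ^ 2 / k ^ 10 = 1 / k ^ 8 := by
    field_simp
  have hk8 : 1 / k ^ 8 ≤ τ ^ 8 := by
    rw [hτdef, div_pow, one_pow]
    apply one_div_le_one_div_of_le (by positivity)
    exact pow_le_pow_left₀ hu0.le hk 8
  have hτ8 : τ ^ 8 ≤ τ := by
    have : τ ^ 8 ≤ τ ^ 1 := pow_le_pow_of_le_one hτ0.le (by linarith) (by norm_num)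
    simpa using this
  have hk2 : 1 / k ^ 2 ≤ τ ^ 2 := by
    rw [hτdef, div_pow, one_pow]
    apply one_div_le_one_div_of_le (by positivity)
    exact pow_le_pow_left₀ hu0.le hk 2
  have hL17 : L ≤ 17 / 16 * ℓ := by linarith
  -- term 1
  have hT1 : Real.sqrt ((1 + k ^ 2 / k ^ 10) * L * (1 / k ^ 2 + τ)) ≤ 11 / 10 * s := by
    rw [Real.sqrt_le_left (by positivity)]
    have e : (11 / 10 * s) ^ 2 = 121 / 100 * (τ * ℓ) := by rw [mul_pow, sq, sq, hss]; ring
    rw [e, hA]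
    have a1 : 1 + 1 / k ^ 8 ≤ 1 + τ := by linarith
    have a3 : 1 / k ^ 2 + τ ≤ τ * (1 + τ) := by nlinarith
    calc (1 + 1 / k ^ 8) * L * (1 / k ^ 2 + τ)
        ≤ (1 + τ) * (17 / 16 * ℓ) * (τ * (1 + τ)) := by
          gcongr
      _ = (17 / 16 * (1 + τ) ^ 2) * (τ * ℓ) := by ring
      _ ≤ 121 / 100 * (τ * ℓ) := by
          apply mul_le_mul_of_nonneg_right _ (by positivity)
          nlinarith
  -- term 3
  have hT3 : k ^ 2 / k ^ 10 * L ≤ 1 / 10 * s := by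
    rw [hA]
    have h1 : 1 / k ^ 8 * L ≤ τ ^ 8 * (17 / 16 * ℓ) := by gcongr
    have h2 : τ ^ 8 * (17 / 16 * ℓ) ≤ 1 / 10 * (τ * ℓ) := by
      have : τ ^ 7 * (17 / 16) ≤ 1 / 10 := by
        have h7 : τ ^ 7 ≤ τ := by
          have : τ ^ 7 ≤ τ ^ 1 := pow_le_pow_of_le_one hτ0.le (by linarith) (by norm_num)
          simpa using this
        nlinarith
      nlinarith
    have hs1 : s ≤ 1 := by
      rw [hsdef, Real.sqrt_le_left (by norm_num)]
      linarith
    have h3 : τ * ℓ ≤ s := by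
      calc τ * ℓ = s * s := hss.symm
        _ ≤ 1 * s := mul_le_mul_of_nonneg_right hs1 hs0.le
        _ = s := one_mul s
    linarith
  -- term 2
  have hlogk : ℓ ≤ Real.log k := Real.log_le_log hu0 hk
  have hlogk' : Real.log k ≤ 65 / 64 * ℓ := by
    have h1 : Real.log k ≤ Real.log (2 * u) := Real.log_le_log hk0 (by linarith)
    rw [Real.log_mul (by norm_num) hu0.ne'] at h1
    have hlog2 : Real.log 2 ≤ 1 := by
      have := Real.log_le_sub_one_of_pos (x := 2) (by norm_num); linarith
    linarith
  have hlk0 : 0 < Real.log k := by linarith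
  have hT2 : Real.exp (-L) ≤ 1 / 2 * s := by
    have h1 : Real.exp (-L) ≤
        Real.exp (-ℓ + Real.log (10 * Real.log k) + (6 / (10 * Real.log k) + k ^ 2 / k ^ 10)) :=
      Real.exp_le_exp.2 (by linarith)
    have h2 :
        Real.exp (-ℓ + Real.log (10 * Real.log k) + (6 / (10 * Real.log k) + k ^ 2 / k ^ 10)) =
        τ * (10 * Real.log k) * Real.exp (6 / (10 * Real.log k) + k ^ 2 / k ^ 10) := by
      rw [Real.exp_add, Real.exp_add, Real.exp_log (by positivity), hℓdef, Real.exp_neg,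
        Real.exp_log hu0, hτdef, one_div]
    have hx : 6 / (10 * Real.log k) + k ^ 2 / k ^ 10 ≤ 2 / 100 := by
      rw [hA]
      have e1 : 6 / (10 * Real.log k) ≤ 1 / 100 := by
        rw [div_le_div_iff₀ (by positivity) (by norm_num)]; nlinarith
      have e2 : 1 / k ^ 8 ≤ 1 / 100 := by linarith
      linarith
    have hx0 : 0 ≤ 6 / (10 * Real.log k) + k ^ 2 / k ^ 10 := by positivity
    have h3 : Real.exp (6 / (10 * Real.log k) + k ^ 2 / k ^ 10) ≤ 103 / 100 := by
      set x := 6 / (10 * Real.log k) + k ^ 2 / k ^ 10 with hxdef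
      have h := (abs_le.1 (Real.abs_exp_sub_one_sub_id_le (x := x)
        (by rw [abs_of_nonneg hx0]; linarith))).2
      have hx2 : x ^ 2 ≤ (2 / 100) ^ 2 := pow_le_pow_left₀ hx0 hx 2
      linarith
    have h4 : τ * (10 * Real.log k) * Real.exp (6 / (10 * Real.log k) + k ^ 2 / k ^ 10) ≤
        τ * (10 * (65 / 64 * ℓ)) * (103 / 100) :=
      mul_le_mul (mul_le_mul_of_nonneg_left (by linarith) hτ0.le) h3 (Real.exp_pos _).le
        (by positivity)
    have h5 : τ * (10 * (65 / 64 * ℓ)) * (103 / 100) ≤ 21 / 2 * (τ * ℓ) := by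
      rw [show τ * (10 * (65 / 64 * ℓ)) * (103 / 100) = (10 * (65 / 64) * (103 / 100)) * (τ * ℓ)
        by ring]
      exact mul_le_mul_of_nonneg_right (by norm_num) (by positivity)
    -- `21 τℓ ≤ s` since `τℓ ≤ 1/441`
    have hs21 : s ≤ 1 / 21 := by
      rw [hsdef, Real.sqrt_le_left (by norm_num)]
      linarith
    have h6 : 21 * (τ * ℓ) ≤ s := by
      calc 21 * (τ * ℓ) = (21 * s) * s := by rw [← hss]; ring
        _ ≤ 1 * s := mul_le_mul_of_nonneg_right (by linarith) hs0.le
        _ = s := one_mul s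
    linarith
  have : Real.sqrt ((1 + k ^ 2 / k ^ 10) * L * (1 / k ^ 2 + τ)) + Real.exp (-L) +
      k ^ 2 / k ^ 10 * L ≤ 17 / 10 * s := by linarith
  linarith


end Endgame

/-! ### Choice of the primes and the blocks; proof of Theorem 2 -/

section Main

variable {F : ℕ → ℂ} {ν : ArithmeticFunction ℂ}

/-- **Theorem 2 of Bourgain–Sarnak–Ziegler for `0 < τ ≤ e^{-64}`.**  The primes used are those of
`(k^{10}, e^{1/τ}]`, `k = ⌈1/τ⌉`, in blocks of `k²` consecutive primes.
[cite: BourgainSarnakZiegler2013, Theorem 2] -/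
theorem criterion_of_le {τ : ℝ} (hτ0 : 0 < τ) (hτ1 : τ ≤ Real.exp (-64)) (F : ℕ → ℂ)
    (ν : ArithmeticFunction ℂ) (hF : ∀ n, ‖F n‖ ≤ 1) (hν : ν.IsMultiplicative)
    (hν1 : ∀ n, ‖ν n‖ ≤ 1)
    (hyp : ∀ p₁ p₂ : ℕ, p₁.Prime → p₂.Prime → p₁ ≠ p₂ →
      (p₁ : ℝ) ≤ Real.exp (1 / τ) → (p₂ : ℝ) ≤ Real.exp (1 / τ) →
      ∀ᶠ M : ℕ in atTop, ‖∑ m ∈ Icc 1 M, F (p₁ * m) * conj (F (p₂ * m))‖ ≤ τ * M) :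
    ∀ᶠ N : ℕ in atTop,
      ‖∑ n ∈ Icc 1 N, ν n * F n‖ ≤ 2 * Real.sqrt (τ * Real.log (1 / τ)) * N := by
  -- the parameters
  set u : ℝ := 1 / τ with hudef
  have hu64 : Real.exp 64 ≤ u := by
    have : 1 / Real.exp (-64) ≤ 1 / τ := one_div_le_one_div_of_le hτ0 hτ1
    rwa [Real.exp_neg, one_div, inv_inv] at this
  have he : (810000 : ℝ) ≤ Real.exp 64 := by
    have h1 : (2 : ℝ) ≤ Real.exp 1 := by
      have := Real.add_one_le_exp (1 : ℝ); norm_num at this ⊢; linarith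
    calc (810000 : ℝ) ≤ (2 : ℝ) ^ 64 := by norm_num
      _ ≤ (Real.exp 1) ^ 64 := pow_le_pow_left₀ (by norm_num) h1 64
      _ = Real.exp 64 := by rw [Real.exp_one_pow]; norm_num
  have hu : 810000 ≤ u := he.trans hu64
  have hu0 : 0 < u := by linarith
  have hℓ : 64 ≤ Real.log u := by
    have := Real.log_le_log (Real.exp_pos 64) hu64
    rwa [Real.log_exp] at this
  have hτu : τ = 1 / u := by rw [hudef, one_div_one_div]
  set k : ℕ := ⌈u⌉₊ with hkdef
  have hk : u ≤ k := Nat.le_ceil u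
  have hk1 : (k : ℝ) ≤ u + 1 := (Nat.ceil_lt_add_one hu0.le).le
  have hk2 : 2 ≤ k := by
    have : (2 : ℝ) ≤ k := by linarith
    exact_mod_cast this
  have hkpos : 0 < k := by omega
  set H : ℕ := k ^ 2 with hHdef
  have hH : 0 < H := pow_pos hkpos 2
  set D₀ : ℕ := k ^ 10 with hD₀def
  set X : ℕ := ⌊Real.exp u⌋₊ with hXdef
  have hXle : (X : ℝ) ≤ Real.exp u := Nat.floor_le (Real.exp_pos u).le
  have hX2 : 2 ≤ X := by
    apply Nat.le_floor
    push_cast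
    linarith [Real.add_one_le_exp u]
  have hD₀r : ((D₀ : ℕ) : ℝ) = (k : ℝ) ^ 10 := by rw [hD₀def]; push_cast; ring
  have hDX' : ((D₀ : ℕ) : ℝ) ≤ Real.exp u := by
    rw [hD₀r]
    calc (k : ℝ) ^ 10 ≤ (2 * u) ^ 10 := pow_le_pow_left₀ (by positivity) (by linarith) 10
      _ ≤ Real.exp u := pow_le_exp hu
  have hDX : D₀ ≤ X := Nat.le_floor hDX'
  set P₀ : Finset ℕ := (Finset.Ioc D₀ X).filter Nat.Prime with hP₀def
  have hPmem : ∀ p ∈ P₀, p.Prime ∧ D₀ < p ∧ p ≤ X := fun p hp => by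
    simp only [hP₀def, Finset.mem_filter, Finset.mem_Ioc] at hp
    exact ⟨hp.2, hp.1.1, hp.1.2⟩
  have hPX : ∀ p ∈ P₀, p ≤ X := fun p hp => (hPmem p hp).2.2
  set n₀ := P₀.card with hn₀def
  -- the increasing enumeration of `P₀`, extended past the end by `X + 1 + i`
  have hcard : P₀.card = n₀ := hn₀def.symm
  set q : ℕ → ℕ := fun i => if h : i < n₀ then (P₀.orderEmbOfFin hcard ⟨i, h⟩ : ℕ)
    else X + 1 + i with hqdef
  have hq : StrictMono q := by
    intro a b hab
    simp only [hqdef]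
    by_cases ha : a < n₀ <;> by_cases hb : b < n₀
    · simp only [dif_pos ha, dif_pos hb]
      exact (P₀.orderEmbOfFin hcard).strictMono (Fin.mk_lt_mk.mpr hab)
    · simp only [dif_pos ha, dif_neg hb]
      have := hPX _ (Finset.orderEmbOfFin_mem P₀ hcard ⟨a, ha⟩)
      omega
    · omega
    · simp only [dif_neg ha, dif_neg hb]; omega
  have hqmem : ∀ i < n₀, q i ∈ P₀ := fun i hi => by
    simp only [hqdef, dif_pos hi]
    exact Finset.orderEmbOfFin_mem P₀ hcard _
  have hPq : P₀ ⊆ (Finset.range n₀).image q := by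
    intro p hp
    have : p ∈ Set.range (P₀.orderEmbOfFin hcard) := by
      rw [Finset.range_orderEmbOfFin]; exact hp
    obtain ⟨⟨i, hi⟩, rfl⟩ := this
    exact Finset.mem_image.2 ⟨i, Finset.mem_range.2 hi, by simp only [hqdef, dif_pos hi]⟩
  set J := n₀ / H with hJdef
  have hJH : J * H ≤ n₀ := Nat.div_mul_le_self n₀ H
  have hp : ∀ i < J * H, (q i).Prime := fun i hi => (hPmem _ (hqmem i (lt_of_lt_of_le hi hJH))).1
  have hD₀q : D₀ ≤ q 0 := by
    by_cases h0 : 0 < n₀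
    · exact ((hPmem _ (hqmem 0 h0)).2.1).le
    · simp only [hqdef, dif_neg h0]
      omega
  set D : ℝ := (k : ℝ) ^ 10 with hDdef
  have hDpos : 0 < D := by positivity
  have hDq : D ≤ q 0 := by
    have : ((D₀ : ℕ) : ℝ) ≤ q 0 := by exact_mod_cast hD₀q
    rwa [hD₀r] at this
  -- the pair hypothesis for the chosen primes
  have hcorr : ∀ i < J * H, ∀ i' < J * H, i ≠ i' → ∀ᶠ M : ℕ in atTop,
      ‖∑ m ∈ Finset.Icc 1 M, F (q i * m) * conj (F (q i' * m))‖ ≤ τ * M := by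
    intro i hi i' hi' hne
    have hmi := hPmem _ (hqmem i (lt_of_lt_of_le hi hJH))
    have hmi' := hPmem _ (hqmem i' (lt_of_lt_of_le hi' hJH))
    refine hyp (q i) (q i') hmi.1 hmi'.1 (fun h => hne (hq.injective h)) ?_ ?_
    · exact le_trans (by exact_mod_cast hmi.2.2) hXle
    · exact le_trans (by exact_mod_cast hmi'.2.2) hXle
  -- bounds for `L = ∑ 1/qᵢ`
  set L := ∑ i ∈ Finset.range (J * H), (1 : ℝ) / q i with hLdef
  have hL0 : 0 ≤ L := Finset.sum_nonneg fun _ _ => by positivity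
  have hL1 : L ≤ Real.log u + 4 := by
    have h1 : L ≤ ∑ p ∈ Nat.primesLE X, (1 : ℝ) / p := by
      rw [hLdef, ← Finset.sum_image (f := fun p : ℕ => (1 : ℝ) / (p : ℝ)) (g := q)
        (fun i _ i' _ h => hq.injective h)]
      apply Finset.sum_le_sum_of_subset_of_nonneg
      · intro p hp
        rw [Finset.mem_image] at hp
        obtain ⟨i, hi, rfl⟩ := hp
        have hm := hPmem _ (hqmem i (lt_of_lt_of_le (Finset.mem_range.1 hi) hJH))
        exact Nat.mem_primesLE.2 ⟨hm.2.2, hm.1⟩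
      · intro p _ _
        positivity
    have h2 := Literature.NumberTheory.LFunctions.MertensBound.sum_inv_prime_le X hX2
    have h3 : Real.log (Real.log X) ≤ Real.log u := by
      have hX0 : (0 : ℝ) < X := by exact_mod_cast lt_of_lt_of_le two_pos hX2
      have hlogX : Real.log X ≤ u := by
        have := Real.log_le_log hX0 hXle
        rwa [Real.log_exp] at this
      have hX1 : (1 : ℝ) < X := by exact_mod_cast lt_of_lt_of_le one_lt_two hX2
      exact Real.log_le_log (Real.log_pos hX1) hlogX
    linarith
  have hL2 : Real.log u - Real.log (10 * Real.log k) - 6 / (10 * Real.log k) -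
      (k : ℝ) ^ 2 / (k : ℝ) ^ 10 ≤ L := by
    have h2P : (2 : ℝ) ≤ ((D₀ : ℕ) : ℝ) := by
      rw [hD₀r]
      have : (2 : ℝ) ^ 10 ≤ (k : ℝ) ^ 10 :=
        pow_le_pow_left₀ (by norm_num) (by exact_mod_cast hk2) 10
      linarith [show (2 : ℝ) ^ 10 = 1024 by norm_num]
    have hM := Literature.NumberTheory.LFunctions.MertensBound.loglog_sub_loglog_le_sum_inv_prime
      h2P hDX'
    rw [Nat.floor_natCast, Real.log_exp, hD₀r, Real.log_pow] at hM
    change Real.log u - Real.log ((10 : ℕ) * Real.log k) - 6 / ((10 : ℕ) * Real.log k) ≤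
      ∑ p ∈ P₀, (1 : ℝ) / p at hM
    push_cast at hM
    have hP : ∑ p ∈ P₀, (1 : ℝ) / p ≤ ∑ i ∈ Finset.range n₀, (1 : ℝ) / q i := by
      rw [← Finset.sum_image (f := fun p : ℕ => (1 : ℝ) / (p : ℝ)) (g := q)
        (fun i _ i' _ h => hq.injective h)]
      exact Finset.sum_le_sum_of_subset_of_nonneg hPq fun _ _ _ => by positivity
    have hsplit : ∑ i ∈ Finset.range n₀, (1 : ℝ) / q i =
        L + ∑ i ∈ Finset.Ico (J * H) n₀, (1 : ℝ) / q i := by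
      rw [hLdef, Finset.sum_range_add_sum_Ico _ hJH]
    have htail : ∑ i ∈ Finset.Ico (J * H) n₀, (1 : ℝ) / q i ≤ (k : ℝ) ^ 2 / (k : ℝ) ^ 10 := by
      have hlt : n₀ - J * H < H := by
        have e : H * J + n₀ % H = n₀ := Nat.div_add_mod n₀ H
        have e' : n₀ - J * H = n₀ % H := by
          apply Nat.sub_eq_of_eq_add
          rw [mul_comm]; omega
        rw [e']
        exact Nat.mod_lt n₀ hH
      calc ∑ i ∈ Finset.Ico (J * H) n₀, (1 : ℝ) / q i ≤ ∑ i ∈ Finset.Ico (J * H) n₀, 1 / D := by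
            apply Finset.sum_le_sum
            intro i hi
            have hin : i < n₀ := (Finset.mem_Ico.1 hi).2
            have hDi := (hPmem _ (hqmem i hin)).2.1
            apply one_div_le_one_div_of_le hDpos
            have : ((D₀ : ℕ) : ℝ) ≤ q i := by exact_mod_cast hDi.le
            rwa [hD₀r] at this
        _ = ((n₀ - J * H : ℕ) : ℝ) * (1 / D) := by
            rw [Finset.sum_const, Nat.card_Ico, nsmul_eq_mul]
        _ ≤ H * (1 / D) := by
            apply mul_le_mul_of_nonneg_right _ (by positivity)
            exact_mod_cast hlt.le
        _ = (k : ℝ) ^ 2 / (k : ℝ) ^ 10 := by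
            rw [hHdef, hDdef]; push_cast; ring
    linarith [hM, hP, hsplit, htail]
  -- the endgame
  have hB := endgame hu hℓ hk hk1 hL0 hL1 hL2
  have hHr : (H : ℝ) = (k : ℝ) ^ 2 := by rw [hHdef]; push_cast; ring
  set B := Real.sqrt ((1 + (H : ℝ) / D) * L * (1 / (H : ℝ) + τ)) + Real.exp (-L) +
    (H : ℝ) / D * L with hBdef
  have hBlt : B < 2 * Real.sqrt (τ * Real.log u) := by
    rw [hBdef, hHr, hDdef, hτu]
    exact hB
  set δ := 2 * Real.sqrt (τ * Real.log u) - B with hδdef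
  have hδ : 0 < δ := by linarith
  have hev := eventually_norm_sum_le hF hν hν1 hq hH hτ0.le hp hDpos hDq hcorr hδ
  refine hev.mono fun N hN => ?_
  calc ‖∑ n ∈ Icc 1 N, ν n * F n‖ ≤ (B + δ) * N := hN
    _ = 2 * Real.sqrt (τ * Real.log u) * N := by rw [hδdef]; ring

end Main

end BourgainSarnakZiegler

/-- **Bourgain–Sarnak–Ziegler 2013, Theorem 2** holds (with `τ₀ = e^{-64}`).
[cite: BourgainSarnakZiegler2013, Theorem 2] -/
theorem bourgainSarnakZiegler_criterion_holds : bourgainSarnakZiegler_criterion :=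
  ⟨Real.exp (-64), Real.exp_pos _, fun _ hτ0 hτ1 F ν hF hν hν1 hyp =>
    BourgainSarnakZiegler.criterion_of_le hτ0 hτ1 F ν hF hν hν1 hyp⟩

end Literature.NumberTheory.Sieve
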